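import Summits.ValiantsHypothesis.ValiantsHypothesis.Theses.ScaledPencil
import Summits.ValiantsHypothesis.ValiantsHypothesis.Theses.DetQP
import Summits.ValiantsHypothesis.ValiantsHypothesis.Theorems.ScaledPencilNormalFormSplit

/-!
# Crux `DetqpSuperquadratic` (stmt-ValiantsHypothesis-0318) — line `scaled-pencil`
(tenure sweep g1, T3; director-valiant g8 2026-08-27T16:23:56Z; TABLE row 41)

TRANSFER LINE: the shared superquadratic crux `dc(per_n) ≥ n^{2+ε}` (route DetQP decl, also wanted by
BirkhoffNewtonClass / PermanentClass / UlrichPadded / ScaledPencil) is attacked in the SCALED-PENCIL GAUGE of route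
ScaledPencil: by the landed NormalForm ✓ (stmt-5317: Kempf–Ness scaling + King θ-stability at minimal size) every
affine determinantal expression of per_n of size m = dc(per_n) yields a normal-form pencil (Λ, L) of size ≤ m with
‖Λ‖² + Σ‖L_ij‖² bookkeeping (one α > 0, doubly balanced) and strict expansion of every proper subspace; so the
superquadratic bound for NORMAL-FORM pencils (`stub_scaledPencilSuperquadratic` = the route's asided crux
ScaledPencilSuperquadratic, stmt-5318, verbatim) transfers to dc (`stub_gaugeTransfer`, provable now from
`hasDetRepr_determinantalComplexity_holds` + NormalForm).  Load-bearing stub: `stub_scaledPencilSuperquadratic`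
(open-problem grade: all engines in print saturate at Θ(n²)).  VP ≠ VNP is not proved by anything here.
-/

set_option linter.dupNamespace false

namespace Summit.ValiantsHypothesis.ValiantsHypothesis.Cruxes.DetqpSuperquadratic.ScaledPencilLine

open Summit.ValiantsHypothesis.ValiantsHypothesis

/-- stub (LOAD-BEARING, open-problem): superquadratic size lower bound for normal-form pencils computing per_n
(= Theses.ScaledPencil.ScaledPencilSuperquadratic, stmt-5318, verbatim). -/
theorem stub_scaledPencilSuperquadratic : Theses.ScaledPencil.ScaledPencilSuperquadratic := by
  sorry

/-- stub (provable now, S): gauge transfer — a superquadratic bound in the normal-form gauge is a superquadratic bound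
on dc(per_n): take an expression of size dc(per_n) (`hasDetRepr_determinantalComplexity_holds`), pass to a
normal-form pencil of size m' ≤ dc(per_n) by NormalForm, and apply the gauge bound to it. -/
theorem stub_gaugeTransfer :
    Theses.ScaledPencil.NormalForm → Theses.ScaledPencil.ScaledPencilSuperquadratic →
      Theses.DetQP.DetqpSuperquadratic := by
  sorry

/-- Composition (kernel-checked, no `sorry` of its own): the crux BY NAME, obtained by applying the gauge-transfer
stub to the LANDED proof of NormalForm (`Theorems.ScaledPencilNormalFormSplit.normalForm_proof`, stmt-5317 ✓) and the
load-bearing stub; the kernel closure of this theorem is the crux modulo exactly `stub_gaugeTransfer` and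
`stub_scaledPencilSuperquadratic` (registered shape: no hypotheses — lead reshape 2026-08-27, val-width-glueclose-p1,
replacing the planner's arrow-hypothesis form flagged `skeleton.extra-hypothesis`). -/
theorem DetqpSuperquadratic_of : Theses.DetQP.DetqpSuperquadratic :=
  stub_gaugeTransfer Theorems.ScaledPencilNormalFormSplit.normalForm_proof stub_scaledPencilSuperquadratic

end Summit.ValiantsHypothesis.ValiantsHypothesis.Cruxes.DetqpSuperquadratic.ScaledPencilLine
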